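import Literature.NumberTheory.GaloisRepresentations.GaloisCohomologyLayerInflationCup
import Literature.NumberTheory.GaloisRepresentations.GaloisCohomologyLayerInflationTwo
import Literature.NumberTheory.GaloisRepresentations.ContinuousCohomologyConnecting
import Literature.Algebra.Homology.DiscreteRepGaloisCorollaries
import Literature.Algebra.Homology.DiscreteRepLayerColimitSetup
import Mathlib.RepresentationTheory.Homological.GroupCohomology.LongExactSequence
import HarnessLib

/-!
# Inflation from a finite layer commutes with the connecting maps: `infTwo ρ₁ L (δ_fin z) = δ₁ (infOneLayer ρ₃ L z)`
# — Mathlib's `groupCohomology.δ` at the layer `Γ_K ⧸ Γ_L` versus the native `IsSES.δ₁` (Serre CG I §2.2; NSW (1.5.1))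

Topic `NumberTheory/GaloisRepresentations`; namespace `Literature.NumberTheory.GaloisRepresentations.LayerDelta`.
Statement and proof plan: door-c6 g17's skeleton (HOME memos/door-c6-g17/N2_InfDeltaSkeleton.lean, item (N2) of
memos/FINDING-door-c6-g17.md §2 (d)); proofs: door-c4 g17.  Sequel to `GaloisCohomologyLayerInflationTwo` (`absGaloisLayerRep`,
`infTwo`, `infTwo_H2π`), `GaloisCohomologyLayerInflationCup` (`infOneLayer`, `infOneLayer_H1π`), `ContinuousCohomologyConnecting`
(`IsSES.δ₁`, `δ₁_oneCocycleClass`, `f_connectingCocycle_apply`) and Mathlib's `groupCohomology.δ₁_apply`.  Definitions with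
bodies (`layerMap`, `layerComplex`) and theorems; no named fact, no instance, no notation, no `sorry`.

* `layerMap L ρ ρ' φ` — the map `M^{Γ_L} → M'^{Γ_L}` induced by a continuous equivariant `φ`, in `Rep ℤ (Γ_K ⧸ Γ_L)`;
* `layerComplex L i p hS` — the layer complex `0 → M₁^{Γ_L} → M₂^{Γ_L} → M₃^{Γ_L} → 0` of a short exact `0 → M₁ → M₂ → M₃ → 0`;
* `layerComplex_shortExact` — it is short exact when `Γ_L` acts trivially on `M₂`;
* **`infTwo_δ_eq_δ₁_infOneLayer`** — `infTwo K L ρ₁ (δ_{layer} z) = hS.δ₁ (infOneLayer K L ρ₃ z)` for every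
  `z ∈ H¹(Γ_K ⧸ Γ_L, M₃^{Γ_L})`.

THE POINT (step (d) of the E-side of hR4 in door-c6 g17's `poitouTate_selmerStructure_duality_of_globalTerms_of_imp`, HOME
memos/FINDING-door-c6-g17.md §2): the E-side of the reciprocity sum is computed with FINITE-LEVEL classes `δ_fin y₀`
(door-c4 g17 `classBarInv_inflG_comp_boundary_presentation_idele`), the local terms with the NATIVE `δ₁(loc_v x)`,
`x = infOneLayer y₀`; this file is the bridge `inf ∘ δ_fin = δ₁ ∘ inf`.

HONEST FRAMING: cochain bookkeeping; no arithmetic, no case of BSD or of Poitou–Tate.  Route A of crux `AnticycControlAdditiveK`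
(item 19295, cell bsd-schneider), seat door-c4 gen 17 on door-c6 gen 17's skeleton.

## References
* J.-P. Serre, *Galois Cohomology* (1997), I §2.2 Proposition 8, §2.3. [SerreGaloisCohomology1997]
* J. Neukirch, A. Schmidt, K. Wingberg, *Cohomology of Number Fields* (2nd ed. 2008), (1.3.2), (1.5.1). [NeukirchSchmidtWingberg2008]
* J. S. Milne, *Arithmetic Duality Theorems* (2nd ed. 2006), I §0 (0.8). [MilneADT2006]
-/

noncomputable section

open CategoryTheory groupCohomology Field Literature.Algebra.Homology Literature.Algebra.Homology.DiscreteRep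
open scoped ContRepresentation

namespace Literature.NumberTheory.GaloisRepresentations

namespace LayerDelta

variable {K : Type} [Field K] (L : IntermediateField K (AlgebraicClosure K)) [FiniteDimensional K L] [Normal K L]
variable {M₁ M₂ M₃ : Type}
  [AddCommGroup M₁] [TopologicalSpace M₁] [DiscreteTopology M₁]
  [AddCommGroup M₂] [TopologicalSpace M₂] [DiscreteTopology M₂]
  [AddCommGroup M₃] [TopologicalSpace M₃] [DiscreteTopology M₃]
variable {ρ₁ : DiscreteGaloisModule K M₁} {ρ₂ : DiscreteGaloisModule K M₂} {ρ₃ : DiscreteGaloisModule K M₃}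

omit [FiniteDimensional K L] in
/-- **The map induced on the layer modules `M^{Γ_L} → M'^{Γ_L}` by a continuous equivariant `φ : M → M'`**, as a
morphism of `Rep ℤ (Γ_K ⧸ Γ_L)` (door-c6 g17's skeleton). [cite: SerreGaloisCohomology1997, I §2.2 Proposition 8] -/
def layerMap {M M' : Type} [AddCommGroup M] [TopologicalSpace M] [DiscreteTopology M]
    [AddCommGroup M'] [TopologicalSpace M'] [DiscreteTopology M']
    (ρ : DiscreteGaloisModule K M) (ρ' : DiscreteGaloisModule K M')
    (φ : ρ.toContRepresentation →ⁱL ρ'.toContRepresentation) :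
    absGaloisLayerRep K L ρ ⟶ absGaloisLayerRep K L ρ' :=
  Rep.ofHom
    ⟨{ toFun := fun w => ⟨φ w.1, fun n => by
          have h := congr($(φ.isIntertwining' (n : absoluteGaloisGroup K)) w.1)
          simp only [ContinuousLinearMap.coe_comp, Function.comp_apply,
            ContinuousRep.toContRepresentation_apply_apply] at h
          change ρ' (n : absoluteGaloisGroup K) (φ.toContinuousLinearMap w.1) = φ.toContinuousLinearMap w.1
          rw [← h]
          exact congrArg φ.toContinuousLinearMap (w.2 n)⟩
       map_add' := fun _ _ => Subtype.ext (map_add φ _ _)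
       map_smul' := fun c w => Subtype.ext (map_zsmul φ c _) },
     fun g => by
       induction g using QuotientGroup.induction_on with
       | H σ =>
         refine LinearMap.ext fun w => Subtype.ext ?_
         have h := congr($(φ.isIntertwining' σ) w.1)
         simp only [ContinuousLinearMap.coe_comp, Function.comp_apply,
           ContinuousRep.toContRepresentation_apply_apply] at h
         exact h⟩

omit [FiniteDimensional K L] in
/-- **The layer complex `0 → M₁^{Γ_L} → M₂^{Γ_L} → M₃^{Γ_L} → 0`** of `Rep ℤ (Γ_K ⧸ Γ_L)` attached to a short exact sequence
`0 → M₁ → M₂ → M₃ → 0` of discrete `Γ_K`-modules (door-c6 g17's skeleton). [cite: SerreGaloisCohomology1997, I §2.2 Proposition 8] -/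
def layerComplex (i : ρ₁.toContRepresentation →ⁱL ρ₂.toContRepresentation)
    (p : ρ₂.toContRepresentation →ⁱL ρ₃.toContRepresentation)
    (hS : IsSES (toTopRepHom ρ₁ ρ₂ i) (toTopRepHom ρ₂ ρ₃ p)) :
    ShortComplex (Rep ℤ (absoluteGaloisGroup K ⧸ absGaloisFixingSubgroup L)) :=
  ShortComplex.mk (layerMap L ρ₁ ρ₂ i) (layerMap L ρ₂ ρ₃ p) (by
    refine Rep.hom_ext (Representation.IntertwiningMap.ext (LinearMap.ext fun w => Subtype.ext ?_))
    exact hS.g_f_apply w.1)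

omit [FiniteDimensional K L] in
/-- **The layer complex is short exact when `Γ_L` acts trivially on `M₂`**: a `Γ_L`-invariant of `M₃` lifts to
`M₂ = M₂^{Γ_L}`, and a vector of `M₁` mapping into `M₂` is `Γ_L`-invariant (`M₁ → M₂` injective and equivariant).
[cite: SerreGaloisCohomology1997, I §2.2 Proposition 8][cite: MilneADT2006, I §0 (0.8)] -/
theorem layerComplex_shortExact (i : ρ₁.toContRepresentation →ⁱL ρ₂.toContRepresentation)
    (p : ρ₂.toContRepresentation →ⁱL ρ₃.toContRepresentation)
    (hS : IsSES (toTopRepHom ρ₁ ρ₂ i) (toTopRepHom ρ₂ ρ₃ p))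
    (h₂ : ∀ σ ∈ absGaloisFixingSubgroup L, ∀ m : M₂, ρ₂ σ m = m) :
    (layerComplex L i p hS).ShortExact := by
  have hinj : Function.Injective i := hS.injective
  refine { exact := ?_, mono_f := ?_, epi_g := ?_ }
  · refine LayerColimit.rep_exact_of_forall _ _ _ fun w hw => ?_
    have hw' : p w.1 = 0 := congrArg Subtype.val hw
    obtain ⟨x, hx⟩ := hS.exact_mid w.1 hw'
    refine ⟨⟨x, fun n => hinj ?_⟩, Subtype.ext hx⟩
    have hi := congr($(i.isIntertwining' (n : absoluteGaloisGroup K)) x)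
    simp only [ContinuousLinearMap.coe_comp, Function.comp_apply, ContinuousRep.toContRepresentation_apply_apply] at hi
    change i.toContinuousLinearMap (ρ₁ (n : absoluteGaloisGroup K) x) = i.toContinuousLinearMap x
    change (toTopRepHom ρ₁ ρ₂ i).hom x = w.1 at hx
    change i.toContinuousLinearMap x = w.1 at hx
    rw [hi, hx]
    exact w.2 n
  · exact (Rep.mono_iff_injective _).2 fun x y h => Subtype.ext (hinj (congrArg Subtype.val h))
  · refine (Rep.epi_iff_surjective _).2 fun y => ?_
    refine ⟨⟨hS.lift y.1, fun n => h₂ n n.2 _⟩, Subtype.ext (hS.g_lift y.1)⟩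

variable [CompactSpace (absoluteGaloisGroup K)]

/-- **Inflation from a finite layer commutes with the connecting homomorphisms:
`infTwo ρ₁ L (δ z) = δ₁ (infOneLayer ρ₃ L z)`** for a short exact `0 → M₁ → M₂ → M₃ → 0` of discrete `Γ_K`-modules with
`Γ_L` acting trivially on `M₂`, `δ` Mathlib's connecting map `H¹(Γ_K ⧸ Γ_L, M₃^{Γ_L}) → H²(Γ_K ⧸ Γ_L, M₁^{Γ_L})` of the
layer complex and `δ₁` the tree's native connecting map `H¹(K, M₃) → H²(K, M₁)` (`IsSES.δ₁`, continuous cochains).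
Proof (door-c6 g17's plan): write `z = [ζ]`; lift `ζ` pointwise to `y : Γ_K ⧸ Γ_L → M₂` (`IsSES.lift`; `Γ_L`-invariant
since `Γ_L` is trivial on `M₂`); `x := i⁻¹ (d y)` is a layer 2-cochain with `i ∘ x = d y` (`p (d y) = d ζ = 0`), so
`δ [ζ] = [x]` (Mathlib `groupCohomology.δ₁_apply`) and `infTwo [x] = [(σ, τ) ↦ x(σ̄, τ̄)]` (`infTwo_H2π`); on the other
side `infOneLayer [ζ] = [σ ↦ ζ σ̄] = [p ∘ φ̃]` for the locally constant lift `φ̃ σ = y σ̄` (`infOneLayer_H1π`), and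
`δ₁ [p ∘ φ̃] = [(σ, τ) ↦ i⁻¹(σ φ̃ τ − φ̃ (στ) + φ̃ σ)]` (`IsSES.δ₁_oneCocycleClass`); the two continuous 2-cocycles are
EQUAL (`f_connectingCocycle_apply` and Mathlib's `d₁₂` have the same sign convention).
[cite: SerreGaloisCohomology1997, I §2.2 Proposition 8][cite: NeukirchSchmidtWingberg2008, (1.5.1)] -/
theorem infTwo_δ_eq_δ₁_infOneLayer (i : ρ₁.toContRepresentation →ⁱL ρ₂.toContRepresentation)
    (p : ρ₂.toContRepresentation →ⁱL ρ₃.toContRepresentation)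
    (hS : IsSES (toTopRepHom ρ₁ ρ₂ i) (toTopRepHom ρ₂ ρ₃ p))
    (h₂ : ∀ σ ∈ absGaloisFixingSubgroup L, ∀ m : M₂, ρ₂ σ m = m)
    (z : groupCohomology (absGaloisLayerRep K L ρ₃) 1) :
    infTwo K L ρ₁ (groupCohomology.δ (layerComplex_shortExact L i p hS h₂) 1 2 rfl z) =
      hS.δ₁ (infOneLayer K L ρ₃ z) := by
  haveI := discreteTopology_quotient_absGaloisFixingSubgroup K L
  have hinj : Function.Injective i := hS.injective
  have hi : ∀ (σ : absoluteGaloisGroup K) (m : M₁), i (ρ₁ σ m) = ρ₂ σ (i m) := fun σ m => by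
    have h := congr($(i.isIntertwining' σ) m)
    simp only [ContinuousLinearMap.coe_comp, Function.comp_apply,
      ContinuousRep.toContRepresentation_apply_apply] at h
    exact h
  have hp : ∀ (σ : absoluteGaloisGroup K) (m : M₂), p (ρ₂ σ m) = ρ₃ σ (p m) := fun σ m => by
    have h := congr($(p.isIntertwining' σ) m)
    simp only [ContinuousLinearMap.coe_comp, Function.comp_apply,
      ContinuousRep.toContRepresentation_apply_apply] at h
    exact h
  induction z using H1_induction_on with
  | h ζ =>
  -- the cocycle identity of `ζ`, on values in `M₃`
  have hζ : ∀ q q' : absoluteGaloisGroup K ⧸ absGaloisFixingSubgroup L,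
      (ζ (q * q') : Representation.invariants (ρ₃.toRepresentation.comp (absGaloisFixingSubgroup L).subtype)) =
        (absGaloisLayerRep K L ρ₃).ρ q (ζ q') + ζ q := fun q q' =>
    (groupCohomology.mem_cocycles₁_iff (A := absGaloisLayerRep K L ρ₃) ζ.1).1 ζ.2 q q'
  -- a pointwise lift `y` of `ζ` to `M₂^{Γ_L} = M₂`
  let y : absoluteGaloisGroup K ⧸ absGaloisFixingSubgroup L → absGaloisLayerRep K L ρ₂ := fun q =>
    ⟨hS.lift (ζ q).1, fun n => h₂ n n.2 _⟩
  have hy1 : ∀ q, (y q).1 = hS.lift (ζ q).1 := fun q => rfl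
  have hpy : ∀ q, p (y q).1 = (ζ q).1 := fun q => hS.g_lift (ζ q).1
  have hy : (layerComplex L i p hS).g.hom ∘ y = ζ := funext fun q => Subtype.ext (hpy q)
  -- the values `d y (q, q') ∈ M₂` are killed by `p`
  have hd : ∀ q q' : absoluteGaloisGroup K ⧸ absGaloisFixingSubgroup L,
      ((d₁₂ (layerComplex L i p hS).X₂ y (q, q')).1 : M₂) =
        ((absGaloisLayerRep K L ρ₂).ρ q (y q')).1 - (y (q * q')).1 + (y q).1 := fun q q' => by
    rw [groupCohomology.d₁₂_hom_apply]
    rfl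
  have hker : ∀ q q' : absoluteGaloisGroup K ⧸ absGaloisFixingSubgroup L,
      p ((d₁₂ (layerComplex L i p hS).X₂ y (q, q')).1 : M₂) = 0 := fun q q' => by
    induction q using QuotientGroup.induction_on with
    | H σ =>
    rw [hd, map_add, map_sub]
    change p (ρ₂ σ (y (q' : _)).1) - _ + _ = 0
    rw [hp, hpy, hpy, hpy]
    have h1 := congrArg Subtype.val (hζ (σ : absoluteGaloisGroup K ⧸ absGaloisFixingSubgroup L) q')
    change ((ζ ((σ : absoluteGaloisGroup K ⧸ absGaloisFixingSubgroup L) * q')).1 : M₃) =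
      ρ₃ σ (ζ q').1 + (ζ (σ : absoluteGaloisGroup K ⧸ absGaloisFixingSubgroup L)).1 at h1
    rw [h1]
    abel
  -- the 2-cochain `x = i⁻¹ (d y)` with values in `M₁^{Γ_L}`
  let x : (absoluteGaloisGroup K ⧸ absGaloisFixingSubgroup L) × (absoluteGaloisGroup K ⧸ absGaloisFixingSubgroup L) →
      absGaloisLayerRep K L ρ₁ := fun qq =>
    ⟨hS.inv ((d₁₂ (layerComplex L i p hS).X₂ y qq).1 : M₂), fun n => hinj (by
      change i (ρ₁ (n : absoluteGaloisGroup K) _) = i _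
      rw [hi]
      change ρ₂ _ ((toTopRepHom ρ₁ ρ₂ i).hom (hS.inv _)) = (toTopRepHom ρ₁ ρ₂ i).hom (hS.inv _)
      rw [hS.f_inv (hker qq.1 qq.2)]
      exact (d₁₂ (layerComplex L i p hS).X₂ y qq).2 n)⟩
  have hx : (layerComplex L i p hS).f.hom ∘ x = d₁₂ (layerComplex L i p hS).X₂ y := funext fun qq =>
    Subtype.ext (hS.f_inv (hker qq.1 qq.2))
  have hδ : groupCohomology.δ (layerComplex_shortExact L i p hS h₂) 1 2 rfl (H1π (absGaloisLayerRep K L ρ₃) ζ) =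
      H2π (absGaloisLayerRep K L ρ₁) ⟨x, groupCohomology.mem_cocycles₂_of_comp_eq_d₁₂
        (layerComplex_shortExact L i p hS h₂) hx⟩ :=
    groupCohomology.δ₁_apply (layerComplex_shortExact L i p hS h₂) ζ y hy x hx
  rw [hδ, infTwo_H2π, infOneLayer_H1π]
  -- the native side: the locally constant lift `φ̃ σ = y σ̄`
  let φt : C(absoluteGaloisGroup K, M₂) :=
    ⟨fun σ => (y (σ : absoluteGaloisGroup K ⧸ absGaloisFixingSubgroup L)).1,
      (continuous_of_discreteTopology (f := fun q : absoluteGaloisGroup K ⧸ absGaloisFixingSubgroup L => (y q).1)).comp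
        (QuotientGroup.continuous_mk (N := absGaloisFixingSubgroup L))⟩
  have hφt : ∀ σ, φt σ = (y (σ : absoluteGaloisGroup K ⧸ absGaloisFixingSubgroup L)).1 := fun _ => rfl
  have hφ : ∀ σ τ : absoluteGaloisGroup K, (toTopRepHom ρ₂ ρ₃ p).hom (φt (σ * τ)) =
      (toTopRepHom ρ₂ ρ₃ p).hom (φt σ) + ρ₃ σ ((toTopRepHom ρ₂ ρ₃ p).hom (φt τ)) := fun σ τ => by
    change p (y _).1 = p (y _).1 + ρ₃ σ (p (y _).1)
    rw [hpy, hpy, hpy]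
    have h1 := congrArg Subtype.val (hζ (σ : absoluteGaloisGroup K ⧸ absGaloisFixingSubgroup L)
      (τ : absoluteGaloisGroup K ⧸ absGaloisFixingSubgroup L))
    change ((ζ ((σ * τ : absoluteGaloisGroup K) : absoluteGaloisGroup K ⧸ absGaloisFixingSubgroup L)).1 : M₃) =
      ρ₃ σ (ζ (τ : absoluteGaloisGroup K ⧸ absGaloisFixingSubgroup L)).1 +
        (ζ (σ : absoluteGaloisGroup K ⧸ absGaloisFixingSubgroup L)).1 at h1
    rw [h1, add_comm]
  have hpush : inflateOneCocycle K L ρ₃ ζ = IsSES.pushCocycle φt hφ :=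
    Subtype.ext (ContinuousMap.ext fun σ => by
      rw [inflateOneCocycle_apply, IsSES.pushCocycle_apply]
      exact (hpy _).symm)
  rw [hpush, hS.δ₁_oneCocycleClass]
  -- the two 2-cocycles coincide: `i⁻¹(d y)(σ̄, τ̄) = i⁻¹(σ φ̃(τ) - φ̃(στ) + φ̃(σ))`
  have hc : inflateTwoCocycle K L ρ₁ ⟨x, groupCohomology.mem_cocycles₂_of_comp_eq_d₁₂
      (layerComplex_shortExact L i p hS h₂) hx⟩ = hS.connectingCocycle φt hφ :=
    Subtype.ext (ContinuousMap.ext fun στ => by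
      obtain ⟨σ, τ⟩ := στ
      apply hinj
      change (toTopRepHom ρ₁ ρ₂ i).hom _ = (toTopRepHom ρ₁ ρ₂ i).hom ((hS.connectingCocycle φt hφ).1 (σ, τ))
      rw [hS.f_connectingCocycle_apply, inflateTwoCocycle_apply]
      change (toTopRepHom ρ₁ ρ₂ i).hom (hS.inv _) = _
      rw [hS.f_inv (hker _ _), hd]
      rfl)
  rw [hc]

/-! ## Restored helper lemmas of door-c6 g17's version of this file (p614536; overwritten by p615106 — the two files
were proposed independently within minutes of each other on the same skeleton; statements reconstructed) -/

omit [FiniteDimensional K L] [CompactSpace (absoluteGaloisGroup K)] in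
/-- Unfolding `layerMap` on vectors: `(layerMap φ w : M') = φ w`. [cite: SerreGaloisCohomology1997, I §2.2 Proposition 8] -/
@[simp] theorem layerMap_hom_apply_coe {M M' : Type} [AddCommGroup M] [TopologicalSpace M] [DiscreteTopology M]
    [AddCommGroup M'] [TopologicalSpace M'] [DiscreteTopology M']
    (ρ : DiscreteGaloisModule K M) (ρ' : DiscreteGaloisModule K M')
    (φ : ρ.toContRepresentation →ⁱL ρ'.toContRepresentation) (w : absGaloisLayerRep K L ρ) :
    (((layerMap L ρ ρ' φ).hom w : absGaloisLayerRep K L ρ') : M') = φ (w : M) := rfl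

omit [FiniteDimensional K L] [CompactSpace (absoluteGaloisGroup K)] in
/-- **Exactness of the layer complex in the middle needs no hypothesis**: a `Γ_L`-invariant of `M₂` killed by `p` is the
image of a (necessarily `Γ_L`-invariant) vector of `M₁` (`M₁ → M₂` injective and equivariant).
[cite: SerreGaloisCohomology1997, I §2.2 Proposition 8] -/
theorem exists_layerMap_eq (i : ρ₁.toContRepresentation →ⁱL ρ₂.toContRepresentation)
    (p : ρ₂.toContRepresentation →ⁱL ρ₃.toContRepresentation)
    (hS : IsSES (toTopRepHom ρ₁ ρ₂ i) (toTopRepHom ρ₂ ρ₃ p))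
    (w : absGaloisLayerRep K L ρ₂) (hw : (layerMap L ρ₂ ρ₃ p).hom w = 0) :
    ∃ x : absGaloisLayerRep K L ρ₁, (layerMap L ρ₁ ρ₂ i).hom x = w := by
  have hinj : Function.Injective i := hS.injective
  have hw' : p w.1 = 0 := congrArg Subtype.val hw
  obtain ⟨x, hx⟩ := hS.exact_mid w.1 hw'
  refine ⟨⟨x, fun n => hinj ?_⟩, Subtype.ext hx⟩
  have hi := congr($(i.isIntertwining' (n : absoluteGaloisGroup K)) x)
  simp only [ContinuousLinearMap.coe_comp, Function.comp_apply, ContinuousRep.toContRepresentation_apply_apply] at hi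
  change i.toContinuousLinearMap (ρ₁ (n : absoluteGaloisGroup K) x) = i.toContinuousLinearMap x
  change (toTopRepHom ρ₁ ρ₂ i).hom x = w.1 at hx
  change i.toContinuousLinearMap x = w.1 at hx
  rw [hi, hx]
  exact w.2 n

omit [CompactSpace (absoluteGaloisGroup K)] in
/-- The main theorem without the `[CompactSpace Γ_K]` section hypothesis (`Γ_K` IS compact: `absoluteGaloisGroup_compactSpace`;
door-c6 g17's version p614536 was stated under the corresponding local instance).
[cite: SerreGaloisCohomology1997, I §2.2 Proposition 8][cite: NeukirchSchmidtWingberg2008, (1.5.1)] -/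
theorem infTwo_δ_eq_δ₁_infOneLayer' (i : ρ₁.toContRepresentation →ⁱL ρ₂.toContRepresentation)
    (p : ρ₂.toContRepresentation →ⁱL ρ₃.toContRepresentation)
    (hS : IsSES (toTopRepHom ρ₁ ρ₂ i) (toTopRepHom ρ₂ ρ₃ p))
    (h₂ : ∀ σ ∈ absGaloisFixingSubgroup L, ∀ m : M₂, ρ₂ σ m = m)
    (z : groupCohomology (absGaloisLayerRep K L ρ₃) 1) :
    haveI : CompactSpace (absoluteGaloisGroup K) := absoluteGaloisGroup_compactSpace K
    infTwo K L ρ₁ (groupCohomology.δ (layerComplex_shortExact L i p hS h₂) 1 2 rfl z) =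
      hS.δ₁ (infOneLayer K L ρ₃ z) := by
  haveI : CompactSpace (absoluteGaloisGroup K) := absoluteGaloisGroup_compactSpace K
  exact infTwo_δ_eq_δ₁_infOneLayer L i p hS h₂ z

end LayerDelta

end Literature.NumberTheory.GaloisRepresentations

end
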